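import Mathlib
import HarnessLib
import Summits.ResolutionOfSingularities.ResolutionOfSingularities.Theorems.WildQuotientsWildQuotientResolutionS1aKillCriterion
import Summits.ResolutionOfSingularities.ResolutionOfSingularities.Theorems.WildQuotientsWildQuotientResolutionS1aBlowupChartNode

/-!
# S1a — RING KILL DATA FROM A CERTIFICATE (KC2) and from the initial-form criterion; admissibility checked on generators

[OURS · L1 W4.5c · lead-1 g10; plan-1 g13 KILL-CRITERION v1 KC2 + SUCCESSOR-BRIEF v1.3 §4 item 2 (the typed census kill leaf)] — NOT statements of
the manuscript; counted 0; AI-level work, weaker than expert review. Crux stmt-ResolutionOfSingularities-17941 `CyclicQuotientFourfolds`, line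
`s1a-logminvertex` v10, K-side (`stub_killTouchReachAux`) and the killability clause of the A-side (`killableAt_over_of_ringKillData`, p628829).

* `map_le_of_admissible` — boundary-admissibility (a′) implies σ-adaptedness `σ(𝒥ₙ) ⊆ 𝒥ₙ` (the `hσJ` of every node statement);
* ★ `admissible_of_generators` — (a′) `y ∈ 𝒥ₙ ⇒ σ y − y ∈ β 𝒥ₙ₊₁` for ALL `n, y` follows from its instances on a generating set `G` of `B`
  (`σ g − g ∈ β 𝒥₁`) and on the centre (`σ fᵢ − fᵢ ∈ β 𝒥_{wᵢ+1}`) — the twisted Leibniz rule; so (a′) is the census' finitely many weight inequalities;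
* **KC2** `ringKillData_of_cert` — centre data of a node + a cobordant kill certificate for every admissible `(hp, hσp)` ⇒ `RingKillData`;
* ★★ `ringKillData_of_admissible_of_irrelevant` — KC2 ∘ KC3: centre data + (a′) + (ii) + (i) ⇒ `RingKillData p r B 𝒜 σ`;
* ★★ `ringKillData_smoothTransversalType` — KC2 ∘ KC3 ∘ KC4: THE TYPED CENSUS KILL LEAF — in any node `(B, 𝒜, σ)`, a K1′-regular σ-adapted
  homogeneous centre `(x₁, x₃)` with weights `(2, 1)` and a Veronese degree, boundary-admissible for `β` with the centre isolated in `V((augIdeal σ : β))`,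
  and `in₂ θ(x₃) = h̄ x̄₁ʼ`, `in₁ θ(x₄) = ū x̄₃ʼ` with `h, u` units ⇒ `RingKillData p r B 𝒜 σ` (the kill clause on EVERY σ-fixed chart, every `d' > 0`).
-/

set_option linter.dupNamespace false

noncomputable section

open Literature.AlgebraicGeometry.Resolution
open scoped LaurentPolynomial
open Summit.ResolutionOfSingularities.ResolutionOfSingularities.Theorems.WildQuotientResolution.S1.CoarseChart
open Summit.ResolutionOfSingularities.ResolutionOfSingularities.Theorems.WildQuotientResolution.S1.BlowupCharts

namespace Summit.ResolutionOfSingularities.ResolutionOfSingularities.Theorems.WildQuotientResolution.S1.KillCert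

universe u

/-! ## Boundary-admissibility: consequences and generators -/

section Admissible

variable {B : Type u} [CommRing B] {c : ℕ} (f : Fin c → B) (w : Fin c → ℕ) (σ : B ≃+* B) (β : B)

/-- **(a′) ⇒ σ-adaptedness**: if `y ∈ 𝒥ₙ ⇒ σ y − y ∈ β · 𝒥ₙ₊₁` then `σ(𝒥ₙ) ⊆ 𝒥ₙ` (`σ y = y + β j`, `j ∈ 𝒥ₙ₊₁ ⊆ 𝒥ₙ`). [OURS · L1 W4.5c] -/
theorem map_le_of_admissible
    (hadm : ∀ (n : ℕ) (y : B), y ∈ (weightedFiltration f w).ideal n →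
      σ y - y ∈ Ideal.span {β} * (weightedFiltration f w).ideal (n + 1)) (n : ℕ) :
    ((weightedFiltration f w).ideal n).map (σ : B →+* B) ≤ (weightedFiltration f w).ideal n := by
  rw [Ideal.map_le_iff_le_comap]
  intro y hy
  rw [Ideal.mem_comap, RingHom.coe_coe, ← sub_add_cancel (σ y) y]
  refine Ideal.add_mem _ ?_ hy
  exact (weightedFiltration f w).antitone (Nat.le_succ n) (Ideal.mul_le_left (hadm n y hy))

/-- The twisted Leibniz rule: if `a ∈ 𝒥_m`, `b ∈ 𝒥_n` have increments in `β 𝒥_{m+1}`, `β 𝒥_{n+1}`, then `ab` has increment in `β 𝒥_{m+n+1}`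
(`σ(ab) − ab = σa (σb − b) + (σa − a) b`, `σ a ∈ 𝒥_m`). [OURS · L1 W4.5c] -/
theorem sub_mem_of_mul {m n : ℕ} {a b : B} (ha : a ∈ (weightedFiltration f w).ideal m) (hb : b ∈ (weightedFiltration f w).ideal n)
    (hσa : σ a - a ∈ Ideal.span {β} * (weightedFiltration f w).ideal (m + 1))
    (hσb : σ b - b ∈ Ideal.span {β} * (weightedFiltration f w).ideal (n + 1)) :
    σ (a * b) - a * b ∈ Ideal.span {β} * (weightedFiltration f w).ideal (m + n + 1) := by
  have hσa' : σ a ∈ (weightedFiltration f w).ideal m := by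
    rw [← sub_add_cancel (σ a) a]
    exact Ideal.add_mem _ ((weightedFiltration f w).antitone (Nat.le_succ m) (Ideal.mul_le_left hσa)) ha
  have e : σ (a * b) - a * b = σ a * (σ b - b) + (σ a - a) * b := by rw [map_mul]; ring
  rw [e]
  refine Ideal.add_mem _ ?_ ?_
  · have h1 : σ a * (σ b - b) ∈ (weightedFiltration f w).ideal m * (Ideal.span {β} * (weightedFiltration f w).ideal (n + 1)) :=
      Ideal.mul_mem_mul hσa' hσb
    rw [mul_left_comm] at h1
    have h2 := Ideal.mul_mono_right (I := Ideal.span {β}) ((weightedFiltration f w).mul_le m (n + 1)) h1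
    rwa [show m + (n + 1) = m + n + 1 by ring] at h2
  · have h1 : (σ a - a) * b ∈ Ideal.span {β} * (weightedFiltration f w).ideal (m + 1) * (weightedFiltration f w).ideal n :=
      Ideal.mul_mem_mul hσa hb
    rw [mul_assoc] at h1
    have h2 := Ideal.mul_mono_right (I := Ideal.span {β}) ((weightedFiltration f w).mul_le (m + 1) n) h1
    rwa [show m + 1 + n = m + n + 1 by ring] at h2

/-- ★ **Boundary-admissibility is checked on generators.** Let `G ⊆ B` generate `B` as a ring. If `σ g − g ∈ β 𝒥₁` for `g ∈ G` and
`σ fᵢ − fᵢ ∈ β 𝒥_{wᵢ+1}` for the centre, then (a′) holds: `y ∈ 𝒥ₙ ⇒ σ y − y ∈ β 𝒥ₙ₊₁` for all `n, y` (twisted Leibniz on the monomials `f^α`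
and on their coefficients). [OURS · L1 W4.5c · KILL-CRITERION v1 (a′) on coordinates; NOT a statement of the manuscript] -/
theorem admissible_of_generators (G : Set B) (hG : Subring.closure G = ⊤)
    (h0 : ∀ g ∈ G, σ g - g ∈ Ideal.span {β} * (weightedFiltration f w).ideal 1)
    (hf : ∀ i, σ (f i) - f i ∈ Ideal.span {β} * (weightedFiltration f w).ideal (w i + 1)) (n : ℕ) (y : B)
    (hy : y ∈ (weightedFiltration f w).ideal n) :
    σ y - y ∈ Ideal.span {β} * (weightedFiltration f w).ideal (n + 1) := by
  -- degree 0: every element of `B` is moved within `β 𝒥₁`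
  have hall : ∀ b : B, σ b - b ∈ Ideal.span {β} * (weightedFiltration f w).ideal 1 := by
    intro b
    have hb : b ∈ ReesKill.movedWithin σ (Ideal.span {β} * (weightedFiltration f w).ideal 1) := by
      have hle : Subring.closure G ≤ ReesKill.movedWithin σ (Ideal.span {β} * (weightedFiltration f w).ideal 1) :=
        Subring.closure_le.mpr fun g hg => h0 g hg
      exact hle (by rw [hG]; trivial)
    exact hb
  -- monomials `f^α` of weight `W` are moved within `β 𝒥_{W+1}`
  have hmon : ∀ α : Fin c →₀ ℕ, σ (α.prod fun i e => f i ^ e) - α.prod (fun i e => f i ^ e) ∈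
      Ideal.span {β} * (weightedFiltration f w).ideal (Finsupp.weight w α + 1) := by
    intro α
    induction α using Finsupp.induction with
    | zero =>
      rw [Finsupp.prod_zero_index, map_zero, zero_add]
      exact hall 1
    | single_add i k α hi hk ih =>
      rw [prod_pow_add, map_add, Finsupp.weight_single, smul_eq_mul,
        Finsupp.prod_single_index (h := fun i e => f i ^ e) (pow_zero _)]
      have hpow : ∀ l : ℕ, f i ^ l ∈ (weightedFiltration f w).ideal (l * w i) ∧
          σ (f i ^ l) - f i ^ l ∈ Ideal.span {β} * (weightedFiltration f w).ideal (l * w i + 1) := by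
        intro l
        induction l with
        | zero =>
          refine ⟨by rw [zero_mul, (weightedFiltration f w).ideal_zero]; trivial, ?_⟩
          rw [pow_zero, zero_mul, zero_add]
          exact hall 1
        | succ l ihl =>
          refine ⟨?_, ?_⟩
          · have := (weightedFiltration f w).mul_le _ _ (Ideal.mul_mem_mul ihl.1 (mem_weightedFiltration_ideal f w i))
            rwa [← pow_succ, show l * w i + w i = (l + 1) * w i by ring] at this
          · have := sub_mem_of_mul f w σ β ihl.1 (mem_weightedFiltration_ideal f w i) ihl.2 (hf i)
            rwa [← pow_succ, show l * w i + w i + 1 = (l + 1) * w i + 1 by ring] at this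
      have hrest : α.prod (fun i e => f i ^ e) ∈ (weightedFiltration f w).ideal (Finsupp.weight w α) :=
        Ideal.subset_span ⟨α, le_rfl, rfl⟩
      have := sub_mem_of_mul f w σ β (hpow k).1 hrest (hpow k).2 ih
      rwa [show k * w i + Finsupp.weight w α + 1 = k * w i + Finsupp.weight w α + 1 by ring] at this
  -- span induction over `𝒥ₙ`
  rw [weightedFiltration_ideal] at hy
  induction hy using Submodule.span_induction with
  | mem m hm =>
    obtain ⟨α, hα, rfl⟩ := hm
    exact Ideal.mul_mono_right ((weightedFiltration f w).antitone (Nat.succ_le_succ hα)) (hmon α)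
  | zero =>
    rw [map_zero, sub_zero]
    exact Ideal.zero_mem _
  | add a b _ _ ha hb =>
    have e : σ (a + b) - (a + b) = (σ a - a) + (σ b - b) := by rw [map_add]; ring
    rw [e]
    exact Ideal.add_mem _ ha hb
  | smul r a ha' ha =>
    rw [smul_eq_mul]
    have := sub_mem_of_mul f w σ β (mem_weightedFiltration_zero f w r) (by rw [weightedFiltration_ideal]; exact ha') (hall r) ha
    rwa [zero_add] at this

end Admissible

/-! ## KC2: ring kill data from a certificate -/

section Node

variable {p : ℕ} {m : ℕ} (r : Fin m → ℕ) (B : Type u) [CommRing B] (𝒜 : (Π j : Fin m, ZMod (r j)) → AddSubgroup B)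
  [GradedRing 𝒜] (σ : B ≃+* B)

/-- **KC2.** Centre data of a node (a K1′-regular σ-adapted homogeneous weighted centre with `0 < c`, positive weights, a Veronese degree) + a
cobordant kill certificate for every admissible `(hp, hσp)` ⇒ `RingKillData` (the kill clause by KC1). [OURS · L1 W4.5c · KILL-CRITERION v1 KC2;
NOT a statement of the manuscript] -/
theorem ringKillData_of_cert {c : ℕ} (f : Fin c → B) (δ : Fin c → Π j : Fin m, ZMod (r j)) (w : Fin c → ℕ) (d : ℕ)
    (hc : 0 < c) (hf : ∀ i, f i ∈ 𝒜 (δ i)) (hw : ∀ i, 0 < w i)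
    (hK1 : RingTheory.Sequence.IsRegular B (List.ofFn f)) (hK1' : IsRegularRing (B ⧸ Ideal.span (Set.range f)))
    (hσJ : ∀ n : ℕ, ((weightedFiltration f w).ideal n).map (σ : B →+* B) ≤ (weightedFiltration f w).ideal n)
    (hver : VeroneseNormalised 𝒜 f w d)
    (hcert : ∀ (hp : 0 < p) (hσp : ∀ x : B, (⇑σ)^[p] x = x),
      ∃ g : ↥(cobordantAlgebra f w), CobordantKillCert f w σ hσJ hp hσp g) :
    RingKillData p r B 𝒜 σ := by
  refine ⟨c, f, δ, w, d, hc, hf, hw, hK1, hK1', hσJ, hver, ?_⟩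
  intro hp hσp d' b hb hσb hd'
  obtain ⟨g, hg⟩ := hcert hp hσp
  exact isPrincipal_augmentationIdeal_sigmaChart_of_cert f w σ hσJ hp hσp 𝒜 hd' b hb hσb hg

/-- ★★ **KC2 ∘ KC3: ring kill data from the initial-form criterion.** Centre data of a node + a boundary element `β` with (a′) boundary-admissibility
(δ = 1), (ii) isolation `(f)^N ≤ (augIdeal σ : β)` and (i) irrelevance of the shifted initial forms `vertexIdeal^N ≤ (augIdeal σ_R : βs) ⊔ (s)` (for
every admissible `(hp, hσp)`, the colon ideal depending on `σ_R`) ⇒ `RingKillData p r B 𝒜 σ`. σ-adaptedness is not a hypothesis (it follows from (a′)).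
[OURS · L1 W4.5c · KILL-CRITERION v1; NOT a statement of the manuscript] -/
theorem ringKillData_of_admissible_of_irrelevant {c : ℕ} (f : Fin c → B) (δ : Fin c → Π j : Fin m, ZMod (r j)) (w : Fin c → ℕ)
    (d : ℕ) (hc : 0 < c) (hf : ∀ i, f i ∈ 𝒜 (δ i)) (hw : ∀ i, 0 < w i)
    (hK1 : RingTheory.Sequence.IsRegular B (List.ofFn f)) (hK1' : IsRegularRing (B ⧸ Ideal.span (Set.range f)))
    (hver : VeroneseNormalised 𝒜 f w d) (β : B)
    (hadm : ∀ (n : ℕ) (y : B), y ∈ (weightedFiltration f w).ideal n →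
      σ y - y ∈ Ideal.span {β} * (weightedFiltration f w).ideal (n + 1))
    (hiso : ∃ N : ℕ, Ideal.span (Set.range f) ^ N ≤ (augmentationIdeal σ).colon (Ideal.span {β}))
    (hirr : ∀ (hp : 0 < p) (hσp : ∀ x : B, (⇑σ)^[p] x = x), ∃ N : ℕ, cobordantAlgebra.vertexIdeal f w ^ N ≤
      (augmentationIdeal (sigmaR σ f w (map_le_of_admissible f w σ β hadm) hp hσp)).colon
          (Ideal.span {algebraMap B (↥(cobordantAlgebra f w)) β * cobordantAlgebra.s f w}) ⊔
        cobordantAlgebra.excIdeal f w) :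
    RingKillData p r B 𝒜 σ :=
  ringKillData_of_cert r B 𝒜 σ f δ w d hc hf hw hK1 hK1' (map_le_of_admissible f w σ β hadm) hver fun hp hσp =>
    ⟨_, cobordantKillCert_of_admissible_of_irrelevant f w σ _ hp hσp β hadm hiso (hirr hp hσp)⟩

/-- ★★ **KC2 ∘ KC3 ∘ KC4 — THE TYPED CENSUS KILL LEAF.** In any node `(B, 𝒜, σ)`: a homogeneous centre `(x₁, x₃) = (f 0, f 1)` with weights `(2, 1)`
which is K1′-regular (regular sequence, regular quotient) with a Veronese degree `d`; a boundary element `β` for which `σ` is boundary-admissible — checked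
on a generating set `G` of `B` (`σ g − g ∈ β 𝒥₁`) and on the centre (`σ x₁ − x₁ ∈ β 𝒥₃`, `σ x₃ − x₃ ∈ β 𝒥₂`) — and the centre is isolated in the residual
locus (`(x₁, x₃)^N ≤ (augIdeal σ : β)`); and the smooth transversal (2,1)-type data: units `h, u` and an element `x₄` with `σ x₃ − x₃ − β h x₁ ∈ β 𝒥₃`,
`σ x₄ − x₄ − β u x₃ ∈ β 𝒥₂`. Then `RingKillData p r B 𝒜 σ`: the augmentation ideal of `σʼ` is principal (`= (β s)`) on EVERY σ-fixed chart `R^w[(bT^{d'})⁻¹]`,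
`d' > 0`, of the weighted blow-up — for every `p`. [OURS · L1 W4.5c · KILL-CRITERION v1 KC2∘KC3∘KC4; NOT a statement of the manuscript] -/
theorem ringKillData_smoothTransversalType (f : Fin 2 → B) (δ : Fin 2 → Π j : Fin m, ZMod (r j)) (d : ℕ)
    (hf : ∀ i, f i ∈ 𝒜 (δ i))
    (hK1 : RingTheory.Sequence.IsRegular B (List.ofFn f)) (hK1' : IsRegularRing (B ⧸ Ideal.span (Set.range f)))
    (hver : VeroneseNormalised 𝒜 f ![2, 1] d) (β x₄ h u : B) (hh : IsUnit h) (hu : IsUnit u)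
    (G : Set B) (hG : Subring.closure G = ⊤)
    (h0 : ∀ g ∈ G, σ g - g ∈ Ideal.span {β} * (weightedFiltration f ![2, 1]).ideal 1)
    (h₁ : σ (f 0) - f 0 ∈ Ideal.span {β} * (weightedFiltration f ![2, 1]).ideal 3)
    (hiso : ∃ N : ℕ, Ideal.span (Set.range f) ^ N ≤ (augmentationIdeal σ).colon (Ideal.span {β}))
    (h₃ : σ (f 1) - f 1 - β * h * f 0 ∈ Ideal.span {β} * (weightedFiltration f ![2, 1]).ideal 3)
    (h₄ : σ x₄ - x₄ - β * u * f 1 ∈ Ideal.span {β} * (weightedFiltration f ![2, 1]).ideal 2) :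
    RingKillData p r B 𝒜 σ := by
  -- (a′) on the centre: `σ x₃ − x₃ = β h x₁ + β j₃ ∈ β 𝒥₂`
  have h₃' : σ (f 1) - f 1 ∈ Ideal.span {β} * (weightedFiltration f ![2, 1]).ideal 2 := by
    have hx₁ : β * h * f 0 ∈ Ideal.span {β} * (weightedFiltration f ![2, 1]).ideal 2 := by
      rw [mul_assoc]
      exact Ideal.mul_mem_mul (Ideal.mem_span_singleton_self β)
        (Ideal.mul_mem_left _ h (mem_weightedFiltration_ideal f ![2, 1] 0))
    have := Ideal.add_mem _ (Ideal.mul_mono_right ((weightedFiltration f ![2, 1]).antitone (by norm_num : 2 ≤ 3)) h₃) hx₁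
    rwa [sub_add_cancel] at this
  have hfw : ∀ i : Fin 2, σ (f i) - f i ∈ Ideal.span {β} * (weightedFiltration f ![2, 1]).ideal ((![2, 1] : Fin 2 → ℕ) i + 1) := by
    intro i
    fin_cases i
    exacts [h₁, h₃']
  have hadm := admissible_of_generators f ![2, 1] σ β G hG h0 hfw
  exact ringKillData_of_cert r B 𝒜 σ f δ ![2, 1] d (by norm_num) hf (fun i => by fin_cases i <;> norm_num) hK1 hK1'
    (map_le_of_admissible f ![2, 1] σ β hadm) hver fun hp hσp =>
      ⟨_, cobordantKillCert_smoothTransversalType σ hp hσp f β x₄ h u hh hu (map_le_of_admissible f ![2, 1] σ β hadm)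
        hadm hiso h₃ h₄⟩

end Node

end Summit.ResolutionOfSingularities.ResolutionOfSingularities.Theorems.WildQuotientResolution.S1.KillCert

end
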